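import Mathlib
import HarnessLib
import Summits.Ventures.LatticeQCDFlow.Scaling.AcceptanceVolumeSandwich
import Summits.Ventures.LatticeQCDFlow.Scaling.AcceptanceEssEightNinths

/-!
# LatticeQCDFlow / Scaling — RIGIDITY of the acceptance volume floor: `∏ᵢ acc(pᵢ, qᵢ) = acc(⊗pᵢ, ⊗qᵢ)`
# holds EXACTLY when all blocks but at most one are hit-or-miss

HONEST FRAMING: exact (Metropolis-corrected) sampling algorithms for lattice gauge theory;
figures of merit are autocorrelation/cost numbers at stated couplings and volumes; no
continuum-physics claim.

Venture `LatticeQCDFlow` (cell pub-lqcd), topic `Scaling`; FANOUT row 3 (`s0-u1-a`, S0-B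
implementation A, GEN-13).  NEW WORK of the cell (elementary finite sums), closing the remark left
open in row 3's `Scaling/AcceptanceVolumeSandwich` (GEN-11, imported: `∏ᵢ accᵢ ≤ acc(⊗)`, attained by
hit-or-miss blocks) — the EQUALITY CASE of the lower volume law; NO definition is introduced.
Vocabulary: `accRate` (row 30's `Exactness/FlowMCMC`), `prodLaw`, `blockProd`, `weight` (row 31's
`Scaling/ImportanceWeights`), `accRate_pos_of_normalised` (row 3's `Scaling/AcceptanceEssEightNinths`).
As in row 3's `Scoring/PairAcceptanceVarianceRigidity`, a pair `(p, q)` (target `p ≥ 0`, model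
`q > 0`) is HIT-OR-MISS when all its positive importance weights agree,
`∀ x x′, 0 < p x → 0 < p x′ → w x = w x′` (equivalently `p = q(· | S)`).

* §1 pointwise: `min(a,a′)·min(b,b′) = min(ab, a′b′)` when `a = a′`, `a = 0` or `a′ = 0`
  (and the mirror cases), and is STRICT (`<`) when `0 < a < a′` and `0 < b′ < b`
  (`min_mul_min_lt_min_mul`); a pair that is not hit-or-miss has two states with
  `0 < p x q x′ < p x′ q x` (`exists_cross_lt_of_not_hitOrMiss`);
* §2 two blocks: the defect `acc(⊗) − acc₁·acc₂` as a four-fold sum of nonnegative terms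
  (`accRate_prodLaw_sub_mul_eq`), and **`accRate_prodLaw_eq_mul_iff`**:
  `acc(p₁⊗p₂, q₁⊗q₂) = acc(p₁,q₁)·acc(p₂,q₂) ↔ (p₁,q₁)` is hit-or-miss `∨ (p₂,q₂)` is hit-or-miss;
  **`mul_accRate_lt_accRate_prodLaw`** — STRICT super-multiplicativity for two blocks that both carry
  two distinct positive weights;
  two-block products of hit-or-miss blocks are hit-or-miss (`hitOrMiss_prodLaw`) and a block that
  is not makes the product not (`not_hitOrMiss_prodLaw_left/right`).  The `m`-block equality case
  (`∏ᵢ accᵢ = acc(⊗)` iff all blocks but at most one are hit-or-miss) is the companion file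
  `Scaling/AcceptanceVolumeFloorRigidityBlocks`.

Reading (value-free): the product of the block acceptances — the floor of the acceptance of a
factorised flow and the rate `Σᵢ log(1/accᵢ)` of its geometric decay in the volume — is the exact
acceptance only in the degenerate situation where every block except possibly one proposes either a
perfect draw or a worthless one; two blocks with genuinely graded weights already accept strictly more
often than the product predicts (opposite weight fluctuations of independent blocks partially cancel in
the Metropolis ratio).  NOT CLAIMED: a quantitative excess over the floor; the general-space
(measure-theoretic) form; anything about coupled (non-factorised) flows; any number of ours.
-/

namespace Summit.Ventures.LatticeQCDFlow.Theory2

open Finset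
open Summit.Ventures.LatticeQCDFlow.Exactness

/-! ## §1 Pointwise equality and strictness of `min(a,a′)·min(b,b′) ≤ min(ab, a′b′)` -/

section Pointwise

/-- Equal first pair: `min(a,a)·min(b,b′) = min(ab, ab′)` for `a ≥ 0`. [folklore] -/
theorem min_mul_min_eq_of_eq {a b b' : ℝ} (ha : 0 ≤ a) :
    min a a * min b b' = min (a * b) (a * b') := by
  rw [min_self, mul_min_of_nonneg _ _ ha]

/-- Equal second pair: `min(a,a′)·min(b,b) = min(ab, a′b)` for `b ≥ 0`. [folklore] -/
theorem min_mul_min_eq_of_eq_right {a a' b : ℝ} (hb : 0 ≤ b) :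
    min a a' * min b b = min (a * b) (a' * b) := by
  rw [min_self, min_mul_of_nonneg _ _ hb]

/-- A zero in the first slot: `min(0,a′)·min(b,b′) = 0 = min(0·b, a′b′)`. [folklore] -/
theorem min_mul_min_eq_of_zero_left {a' b b' : ℝ} (ha' : 0 ≤ a') (hb' : 0 ≤ b') :
    min 0 a' * min b b' = min (0 * b) (a' * b') := by
  rw [min_eq_left ha', zero_mul, zero_mul, min_eq_left (mul_nonneg ha' hb')]

/-- A zero in the second slot: `min(a,0)·min(b,b′) = 0 = min(ab, 0·b′)`. [folklore] -/
theorem min_mul_min_eq_of_zero_right {a b b' : ℝ} (ha : 0 ≤ a) (hb : 0 ≤ b) :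
    min a 0 * min b b' = min (a * b) (0 * b') := by
  rw [min_eq_right ha, zero_mul, zero_mul, min_eq_right (mul_nonneg ha hb)]

/-- **Strictness**: if `0 < a < a′` and `0 < b′ < b` (the two pairs are oppositely ordered and no
zero occurs) then `min(a,a′)·min(b,b′) = a b′ < min(ab, a′b′)`. [ours] -/
theorem min_mul_min_lt_min_mul {a a' b b' : ℝ} (ha : 0 < a) (haa' : a < a') (hb' : 0 < b')
    (hb'b : b' < b) : min a a' * min b b' < min (a * b) (a' * b') := by
  rw [min_eq_left haa'.le, min_eq_right hb'b.le]
  exact lt_min (mul_lt_mul_of_pos_left hb'b ha) (mul_lt_mul_of_pos_right haa' hb')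

variable {X : Type*}

/-- Equal weights at two charged states give equal cross products: `p x q x′ = p x′ q x`.
[folklore] -/
theorem cross_eq_of_weight_eq {p q : X → ℝ} (hq : ∀ x, 0 < q x) {x x' : X}
    (h : weight p q x = weight p q x') : p x * q x' = p x' * q x := by
  unfold weight at h
  rw [div_eq_div_iff (hq x).ne' (hq x').ne'] at h
  linarith

/-- **A pair that is NOT hit-or-miss has two oppositely weighted charged states**:
`∃ x x′, 0 < p x q x′ < p x′ q x`. [ours] -/
theorem exists_cross_lt_of_not_hitOrMiss {p q : X → ℝ} (hq : ∀ x, 0 < q x)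
    (h : ¬ ∀ x x', 0 < p x → 0 < p x' → weight p q x = weight p q x') :
    ∃ x x', 0 < p x * q x' ∧ p x * q x' < p x' * q x := by
  simp only [not_forall, exists_prop] at h
  obtain ⟨x, x', hx, hx', hne⟩ := h
  have key : ∀ {y y' : X}, 0 < p y → weight p q y < weight p q y' →
      0 < p y * q y' ∧ p y * q y' < p y' * q y := by
    intro y y' hy hlt
    refine ⟨mul_pos hy (hq y'), ?_⟩
    unfold weight at hlt
    rwa [div_lt_div_iff₀ (hq y) (hq y')] at hlt
  rcases lt_or_gt_of_ne hne with hlt | hgt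
  · exact ⟨x, x', key hx hlt⟩
  · exact ⟨x', x, key hx' hgt⟩

end Pointwise

/-! ## §2 Two blocks -/

section TwoBlocks

variable {X Y : Type*} [Fintype X] [Fintype Y]

/-- **The defect of the two-block floor as a four-fold sum**:
`acc(p₁⊗p₂, q₁⊗q₂) − acc₁·acc₂ = Σ_{x,x′,y,y′} (min(ab, a′b′) − min(a,a′)·min(b,b′))` with
`a = p₁x q₁x′`, `a′ = p₁x′ q₁x`, `b = p₂y q₂y′`, `b′ = p₂y′ q₂y`. [ours] -/
theorem accRate_prodLaw_sub_mul_eq (p₁ q₁ : X → ℝ) (p₂ q₂ : Y → ℝ) :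
    accRate (prodLaw p₁ p₂) (prodLaw q₁ q₂) - accRate p₁ q₁ * accRate p₂ q₂
      = ∑ x, ∑ x', ∑ y, ∑ y',
          (min (p₁ x * q₁ x' * (p₂ y * q₂ y')) (p₁ x' * q₁ x * (p₂ y' * q₂ y))
            - min (p₁ x * q₁ x') (p₁ x' * q₁ x) * min (p₂ y * q₂ y') (p₂ y' * q₂ y)) := by
  rw [accRate_prodLaw_eq]
  unfold accRate
  simp_rw [sum_mul, mul_sum, ← sum_sub_distrib]

/-- The floor is attained iff it is attained TERM BY TERM. [ours] -/
theorem accRate_prodLaw_eq_mul_iff_forall {p₁ q₁ : X → ℝ} {p₂ q₂ : Y → ℝ} (hp₁ : ∀ x, 0 ≤ p₁ x)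
    (hq₁ : ∀ x, 0 ≤ q₁ x) (hp₂ : ∀ y, 0 ≤ p₂ y) (hq₂ : ∀ y, 0 ≤ q₂ y) :
    accRate (prodLaw p₁ p₂) (prodLaw q₁ q₂) = accRate p₁ q₁ * accRate p₂ q₂ ↔
      ∀ x x' y y', min (p₁ x * q₁ x') (p₁ x' * q₁ x) * min (p₂ y * q₂ y') (p₂ y' * q₂ y)
        = min (p₁ x * q₁ x' * (p₂ y * q₂ y')) (p₁ x' * q₁ x * (p₂ y' * q₂ y)) := by
  have hnn : ∀ x x' y y', 0 ≤ min (p₁ x * q₁ x' * (p₂ y * q₂ y')) (p₁ x' * q₁ x * (p₂ y' * q₂ y))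
      - min (p₁ x * q₁ x') (p₁ x' * q₁ x) * min (p₂ y * q₂ y') (p₂ y' * q₂ y) :=
    fun x x' y y' => sub_nonneg.2 (min_mul_min_le_min_mul (mul_nonneg (hp₁ x) (hq₁ x'))
      (mul_nonneg (hp₁ x') (hq₁ x)) (mul_nonneg (hp₂ y) (hq₂ y')) (mul_nonneg (hp₂ y') (hq₂ y)))
  rw [← sub_eq_zero, accRate_prodLaw_sub_mul_eq,
    sum_eq_zero_iff_of_nonneg fun x _ => sum_nonneg fun x' _ => sum_nonneg fun y _ =>
      sum_nonneg fun y' _ => hnn x x' y y']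
  simp only [mem_univ, true_implies]
  refine forall_congr' fun x => ?_
  rw [sum_eq_zero_iff_of_nonneg fun x' _ => sum_nonneg fun y _ => sum_nonneg fun y' _ => hnn x x' y y']
  simp only [mem_univ, true_implies]
  refine forall_congr' fun x' => ?_
  rw [sum_eq_zero_iff_of_nonneg fun y _ => sum_nonneg fun y' _ => hnn x x' y y']
  simp only [mem_univ, true_implies]
  refine forall_congr' fun y => ?_
  rw [sum_eq_zero_iff_of_nonneg fun y' _ => hnn x x' y y']
  simp only [mem_univ, true_implies]
  refine forall_congr' fun y' => ?_
  rw [sub_eq_zero, eq_comm]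

omit [Fintype X] [Fintype Y] in
/-- A hit-or-miss FIRST block attains the floor term by term. [ours] -/
theorem forall_min_mul_min_eq_of_hitOrMiss_left {p₁ q₁ : X → ℝ} {p₂ q₂ : Y → ℝ}
    (hp₁ : ∀ x, 0 ≤ p₁ x) (hq₁ : ∀ x, 0 < q₁ x) (hp₂ : ∀ y, 0 ≤ p₂ y) (hq₂ : ∀ y, 0 ≤ q₂ y)
    (h₁ : ∀ x x', 0 < p₁ x → 0 < p₁ x' → weight p₁ q₁ x = weight p₁ q₁ x') (x x' : X) (y y' : Y) :
    min (p₁ x * q₁ x') (p₁ x' * q₁ x) * min (p₂ y * q₂ y') (p₂ y' * q₂ y)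
      = min (p₁ x * q₁ x' * (p₂ y * q₂ y')) (p₁ x' * q₁ x * (p₂ y' * q₂ y)) := by
  by_cases hx : p₁ x = 0
  · rw [hx, zero_mul]
    exact min_mul_min_eq_of_zero_left (mul_nonneg (hp₁ x') (hq₁ x).le) (mul_nonneg (hp₂ y') (hq₂ y))
  by_cases hx' : p₁ x' = 0
  · rw [hx', zero_mul]
    exact min_mul_min_eq_of_zero_right (mul_nonneg (hp₁ x) (hq₁ x').le)
      (mul_nonneg (hp₂ y) (hq₂ y'))
  rw [cross_eq_of_weight_eq hq₁ (h₁ x x' ((hp₁ x).lt_of_ne' hx) ((hp₁ x').lt_of_ne' hx'))]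
  exact min_mul_min_eq_of_eq (mul_nonneg (hp₁ x') (hq₁ x).le)

omit [Fintype X] [Fintype Y] in
/-- A hit-or-miss SECOND block attains the floor term by term. [ours] -/
theorem forall_min_mul_min_eq_of_hitOrMiss_right {p₁ q₁ : X → ℝ} {p₂ q₂ : Y → ℝ}
    (hp₁ : ∀ x, 0 ≤ p₁ x) (hq₁ : ∀ x, 0 ≤ q₁ x) (hp₂ : ∀ y, 0 ≤ p₂ y) (hq₂ : ∀ y, 0 < q₂ y)
    (h₂ : ∀ y y', 0 < p₂ y → 0 < p₂ y' → weight p₂ q₂ y = weight p₂ q₂ y') (x x' : X) (y y' : Y) :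
    min (p₁ x * q₁ x') (p₁ x' * q₁ x) * min (p₂ y * q₂ y') (p₂ y' * q₂ y)
      = min (p₁ x * q₁ x' * (p₂ y * q₂ y')) (p₁ x' * q₁ x * (p₂ y' * q₂ y)) := by
  have h := forall_min_mul_min_eq_of_hitOrMiss_left hp₂ hq₂ hp₁ hq₁ h₂ y y' x x'
  rw [mul_comm] at h
  rw [h]
  congr 1 <;> ring

/-- **RIGIDITY OF THE TWO-BLOCK FLOOR**: for nonnegative targets and positive models,
`acc(p₁⊗p₂, q₁⊗q₂) = acc(p₁,q₁)·acc(p₂,q₂)` iff at least one of the two blocks is hit-or-miss.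
(`←`: term by term; `→`: two blocks with graded weights have states `0 < a < a′`, `0 < b′ < b`, where
the term inequality is strict.) [ours] -/
theorem accRate_prodLaw_eq_mul_iff {p₁ q₁ : X → ℝ} {p₂ q₂ : Y → ℝ} (hp₁ : ∀ x, 0 ≤ p₁ x)
    (hq₁ : ∀ x, 0 < q₁ x) (hp₂ : ∀ y, 0 ≤ p₂ y) (hq₂ : ∀ y, 0 < q₂ y) :
    accRate (prodLaw p₁ p₂) (prodLaw q₁ q₂) = accRate p₁ q₁ * accRate p₂ q₂ ↔
      (∀ x x', 0 < p₁ x → 0 < p₁ x' → weight p₁ q₁ x = weight p₁ q₁ x') ∨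
      (∀ y y', 0 < p₂ y → 0 < p₂ y' → weight p₂ q₂ y = weight p₂ q₂ y') := by
  rw [accRate_prodLaw_eq_mul_iff_forall hp₁ (fun x => (hq₁ x).le) hp₂ fun y => (hq₂ y).le]
  constructor
  · intro h
    by_contra hne
    obtain ⟨h₁, h₂⟩ := not_or.1 hne
    obtain ⟨x, x', ha, haa'⟩ := exists_cross_lt_of_not_hitOrMiss hq₁ h₁
    obtain ⟨y', y, hb', hb'b⟩ := exists_cross_lt_of_not_hitOrMiss hq₂ h₂
    exact (min_mul_min_lt_min_mul ha haa' hb' hb'b).ne (h x x' y y')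
  · rintro (h₁ | h₂)
    · exact forall_min_mul_min_eq_of_hitOrMiss_left hp₁ hq₁ hp₂ (fun y => (hq₂ y).le) h₁
    · exact forall_min_mul_min_eq_of_hitOrMiss_right hp₁ (fun x => (hq₁ x).le) hp₂ hq₂ h₂

/-- **STRICT super-multiplicativity**: if neither block is hit-or-miss then
`acc(p₁,q₁)·acc(p₂,q₂) < acc(p₁⊗p₂, q₁⊗q₂)`. [ours] -/
theorem mul_accRate_lt_accRate_prodLaw {p₁ q₁ : X → ℝ} {p₂ q₂ : Y → ℝ} (hp₁ : ∀ x, 0 ≤ p₁ x)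
    (hq₁ : ∀ x, 0 < q₁ x) (hp₂ : ∀ y, 0 ≤ p₂ y) (hq₂ : ∀ y, 0 < q₂ y)
    (h₁ : ¬ ∀ x x', 0 < p₁ x → 0 < p₁ x' → weight p₁ q₁ x = weight p₁ q₁ x')
    (h₂ : ¬ ∀ y y', 0 < p₂ y → 0 < p₂ y' → weight p₂ q₂ y = weight p₂ q₂ y') :
    accRate p₁ q₁ * accRate p₂ q₂ < accRate (prodLaw p₁ p₂) (prodLaw q₁ q₂) := by
  refine lt_of_le_of_ne (mul_accRate_le_accRate_prodLaw hp₁ (fun x => (hq₁ x).le) hp₂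
    fun y => (hq₂ y).le) fun heq => ?_
  have h := (accRate_prodLaw_eq_mul_iff hp₁ hq₁ hp₂ hq₂).1 heq.symm
  tauto

omit [Fintype X] [Fintype Y] in
/-- Both coordinates of a charged state of a product of nonnegative laws are charged. [folklore] -/
theorem pos_pos_of_prodLaw_pos {p₁ : X → ℝ} {p₂ : Y → ℝ} (hp₁ : ∀ x, 0 ≤ p₁ x) {z : X × Y}
    (hz : 0 < prodLaw p₁ p₂ z) : 0 < p₁ z.1 ∧ 0 < p₂ z.2 := by
  rcases pos_and_pos_or_neg_and_neg_of_mul_pos hz with h | ⟨h1, -⟩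
  · exact h
  · exact absurd h1 (not_lt.2 (hp₁ _))

omit [Fintype X] [Fintype Y] in
/-- **A product of two hit-or-miss blocks is hit-or-miss.** [ours] -/
theorem hitOrMiss_prodLaw {p₁ q₁ : X → ℝ} {p₂ q₂ : Y → ℝ} (hp₁ : ∀ x, 0 ≤ p₁ x)
    (h₁ : ∀ x x', 0 < p₁ x → 0 < p₁ x' → weight p₁ q₁ x = weight p₁ q₁ x')
    (h₂ : ∀ y y', 0 < p₂ y → 0 < p₂ y' → weight p₂ q₂ y = weight p₂ q₂ y') :
    ∀ z z', 0 < prodLaw p₁ p₂ z → 0 < prodLaw p₁ p₂ z' →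
      weight (prodLaw p₁ p₂) (prodLaw q₁ q₂) z = weight (prodLaw p₁ p₂) (prodLaw q₁ q₂) z' := by
  intro z z' hz hz'
  obtain ⟨hz1, hz2⟩ := pos_pos_of_prodLaw_pos hp₁ hz
  obtain ⟨hz'1, hz'2⟩ := pos_pos_of_prodLaw_pos hp₁ hz'
  rw [weight_prodLaw, weight_prodLaw, h₁ z.1 z'.1 hz1 hz'1, h₂ z.2 z'.2 hz2 hz'2]

omit [Fintype Y] in
/-- **A product whose SECOND block is not hit-or-miss is not hit-or-miss** (the first block's
target charging at least one state). [ours] -/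
theorem not_hitOrMiss_prodLaw_right {p₁ q₁ : X → ℝ} {p₂ q₂ : Y → ℝ} (hq₁ : ∀ x, 0 < q₁ x)
    (hp₁1 : ∑ x, p₁ x = 1)
    (h₂ : ¬ ∀ y y', 0 < p₂ y → 0 < p₂ y' → weight p₂ q₂ y = weight p₂ q₂ y') :
    ¬ ∀ z z', 0 < prodLaw p₁ p₂ z → 0 < prodLaw p₁ p₂ z' →
      weight (prodLaw p₁ p₂) (prodLaw q₁ q₂) z = weight (prodLaw p₁ p₂) (prodLaw q₁ q₂) z' := by
  classical
  obtain ⟨x₀, -, hx₀⟩ := exists_lt_of_sum_lt (s := univ) (f := fun _ => (0 : ℝ)) (g := p₁)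
    (by rw [sum_const_zero, hp₁1]; exact one_pos)
  intro H
  apply h₂
  intro y y' hy hy'
  have h := H (x₀, y) (x₀, y') (mul_pos hx₀ hy) (mul_pos hx₀ hy')
  rw [weight_prodLaw, weight_prodLaw] at h
  have hw : 0 < weight p₁ q₁ x₀ := div_pos hx₀ (hq₁ x₀)
  exact mul_left_cancel₀ hw.ne' h

omit [Fintype X] in
/-- **A product whose FIRST block is not hit-or-miss is not hit-or-miss.** [ours] -/
theorem not_hitOrMiss_prodLaw_left {p₁ q₁ : X → ℝ} {p₂ q₂ : Y → ℝ} (hq₂ : ∀ y, 0 < q₂ y)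
    (hp₂1 : ∑ y, p₂ y = 1)
    (h₁ : ¬ ∀ x x', 0 < p₁ x → 0 < p₁ x' → weight p₁ q₁ x = weight p₁ q₁ x') :
    ¬ ∀ z z', 0 < prodLaw p₁ p₂ z → 0 < prodLaw p₁ p₂ z' →
      weight (prodLaw p₁ p₂) (prodLaw q₁ q₂) z = weight (prodLaw p₁ p₂) (prodLaw q₁ q₂) z' := by
  classical
  obtain ⟨y₀, -, hy₀⟩ := exists_lt_of_sum_lt (s := univ) (f := fun _ => (0 : ℝ)) (g := p₂)
    (by rw [sum_const_zero, hp₂1]; exact one_pos)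
  intro H
  apply h₁
  intro x x' hx hx'
  have h := H (x, y₀) (x', y₀) (mul_pos hx hy₀) (mul_pos hx' hy₀)
  rw [weight_prodLaw, weight_prodLaw] at h
  have hw : 0 < weight p₂ q₂ y₀ := div_pos hy₀ (hq₂ y₀)
  exact mul_right_cancel₀ hw.ne' h

end TwoBlocks

end Summit.Ventures.LatticeQCDFlow.Theory2
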